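import Literature.Barriers.CriticalPhenomena.SAPAnisotropicNotDFinite242RecurrenceProofs
import Literature.Barriers.CriticalPhenomena.SAPBuildingBlocksSeries
import HarnessLib

/-!
# Discharges of named facts of `SAPAnisotropicNotDFinite242.lean`

`Literature/Barriers/CriticalPhenomena/SAPAnisotropicNotDFinite242Holds.lean` — proofs-only
sibling of `SAPAnisotropicNotDFinite242.lean` (no definitions, no named facts). Each theorem
below closes a named fact `X : Prop` of that file as `X_holds : X` by composing an ACCEPTED
reduction theorem of the tree with the ACCEPTED unconditional `_holds` discharges of all of
its hypotheses; nothing is re-proved and no statement is changed. Recorded by the librarian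
sweep g25 (2026-08-16, pass 5c: facts dischargeable in one line from the tree's own lemmas),
so that the facts census, `#h21_route_deps` and the cone guardrail see these facts as
theorems.

Discharged here:

* `Rechnitzer2006_eq38_holds` := `Rechnitzer2006_eq38_of_lem25_rec`
  `Rechnitzer2006_lem25_rec_holds` (`SAPAnisotropicNotDFinite242RecurrenceProofs.lean`).

## References

* [Rechnitzer2006Haruspicy2] — see `lean/references.bib` and the docstring of the fact in `SAPAnisotropicNotDFinite242.lean`.
-/

namespace Literature.Barriers.CriticalPhenomena

/-- **Discharge of the named fact `Rechnitzer2006_eq38`** (`SAPAnisotropicNotDFinite242.lean`):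
Rechnitzer 2006, proof of Theorem 16, eq. (38) (with eq. (32) and eq. (31)): for `2 ≤ k ≤ n`,
"`f_k(x^{n-k};x) = N(x^{n-k};x)/D(x^{n-k};x) + c_8(x^{n-k};x) f_{k-1}(x^{n-k+1};x)` … and we
note that `D(x^{n-k};x) ∈ ℂ_{n-1}(x)`" (a product of cyclotomic … — obtained as
`Rechnitzer2006_eq38_of_lem25_rec` applied to the tree's unconditional discharge
`Rechnitzer2006_lem25_rec_holds` of its hypothesis (reduction in
`SAPAnisotropicNotDFinite242RecurrenceProofs.lean`).
[cite: Rechnitzer2006Haruspicy2, §3.4, proof of Theorem 16, eq. (38)] -/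
theorem Rechnitzer2006_eq38_holds :
    Rechnitzer2006_eq38 :=
  Rechnitzer2006_eq38_of_lem25_rec Rechnitzer2006_lem25_rec_holds

end Literature.Barriers.CriticalPhenomena
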